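import Mathlib
import Literature.MathematicalPhysics.QuantumFieldTheory.BalabanImbrieJaffe1984to88.BIJ85Prop511Proof
import Literature.MathematicalPhysics.QuantumFieldTheory.BalabanImbrieJaffe1984to88.BIJ85LandauMinimizer442V1
import Literature.MathematicalPhysics.QuantumFieldTheory.BalabanImbrieJaffe1984to88.BIJ85Eq5113Proof

/-!
# `BalabanImbrieJaffe1984to88.BIJ85Prop511Torus` — T. Bałaban, J. Imbrie, A. Jaffe, *Renormalization of the Higgs model:
minimizers, propagators and the stability of mean field theory*, Commun. Math. Phys. **97** (1985) 299–329
[BalabanImbrieJaffe1985]: **Proposition 5.1.1** p. 313–315 [PDF 15–17] ON THE TORUS `T^{(0)}` of the series' lattice calculus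
(`Balaban1983to89.LatticeFieldCalculus`) — `H_{k,Ax}B − H_kB = ∂λ(H_kB)` with `H_{k,Ax}` = p09's `BIJ85AxialMinimizer413.torusHax`
((4.1.3)), `H_k` = p11's `BIJ85LandauMinimizer442.Hk` for the V1 operators `BIJ85LandauMinimizer442V1.opsV1` ((4.4.2)) and `λ` =
p08's `BIJ85GaugeFunction5113.lamOf` ((5.1.4)/(5.1.13)), HYPOTHESIS-FREE in the standing range (file 2 of the row; file 1 =
`…BIJ85Prop511Proof`, the abstract theorem)

statement-level skeleton of published theorems with citation tags; proofs where landed; nothing here is a claim about the Yang–Mills mass gap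

PDF held: `paper:balaban1985-cmp97-bij-higgs-minimizers` (journal page = PDF page + 298); pp. 309, 313–315 [PDF 11, 15–17] read (OCR
text + render `run/shared/lean/pub/lit-balaban/lit-balaban-r15/pages/1985-cmp97-bij-higgs-minimizers-p016-x2.png`).

CITATION HEADER (lean-in-tree rule).  Phase-2 proof seat p30 (gen 4) of `lit-balaban` (HOME `run/shared/lean/pub/lit-balaban/`, unit
`lit-balaban-p30-g4`); SKELETON row **C1.Prop5.1.1** (kind «model-instance» companion of the abstract `…BIJ85Prop511Proof.prop511`),
with a second proof of the p. 309 claim (row **C1.Claim@309**; the torus form for every `k` is p33 gen 2's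
`…BIJ85NoZeroModes309Torus`, landed first — not restated).  THE PRINTED TEXT: see file 1; p. 309,
verbatim: *"The reader may wonder whether ∂ has zero modes on the subspace of gauge fields satisfying Q_kA = 0 and satisfying the
axial gauge condition. Such zero modes do not occur, and as a consequence the integral (4.1.1) is convergent also for noncompact
gauge fields. … A similar argument applies to the δ_{k,Ax} gauge, but we leave out the details."*

WHAT IS PROVED HERE.  The instance of file 1's abstract setting: bond fields `EA = BondSpace P` (= `EuclideanSpace ℝ (PBond P 0)`,
p09's carrier of (4.1.1)/(4.1.3) = p11's carrier of (4.4.2)), the V1 operators `opsV1 P k c s` (`∂ = s·curl c`, `∂*`, `Δ`, `Q_k =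
bondAvgIter k`, `Q′ = siteAvgIter k`; `c = η⁻¹` the lattice factor, `s² = w = η^d` the volume weight), the gauge gradient `gradV1 P c`,
the axial gauge `δ_{k,Ax}` (4.1.2) as the subspace `axialE P k` (NEW definition `axialSub k` = `{A : deltaAx k A}` as a submodule —
p09's `constraint411 k` is its intersection with `{Q_kA = 0}`, = `V411 P k`), and the gauge-function map `lamE P c k` = p08's
`lamOf c k` read on the Euclidean carrier (linear by `lamOf_add/smul`).  Every hypothesis of `…BIJ85Prop511Proof.prop511` is a
THEOREM here in the standing range `k ≤ m + K`, `c ≠ 0`, `s ≠ 0`: `hZ`/`hL`/`hg` = p11's `noZeroModes_V1`/`lapInjective_V1`/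
`gaugeStructure_V1`; `hV` = p09's `mem_V411`; `hlamQ`/`hlamAx`/`hlamU` = p08's `siteAvgIter_lamOf`/`deltaAx_lamOf`/`eq5113`.
* `curlOp_eq_opsV1_curl` — p09's curl `curlOp w c` IS p11's `(opsV1 P k c √w).curl` (same carrier, same weights);
* `noZeroModes_axialE` — p. 309 for the V1 operators on the Euclidean carrier, every `k ≤ m + K` (`c ≠ 0`, `s ≠ 0`), by file 1's
  route (the bond-function form `Q_kA = 0 ∧ δ_{k,Ax}(A) ∧ ∂A = 0 ⇒ A = 0` in the shape of p09's hypothesis `hD` is p33 gen 2's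
  `BIJ85NoZeroModes309Torus.hD_holds`, by block constants + induction in k — an independent proof; not restated here);
* **`prop511_torus`** — PROPOSITION 5.1.1 on the torus: for `k ≤ m + K`, `c ≠ 0`, `w > 0`, every `B` on `T₁^{(k)}` and every
  axial representative `A₀` (`Q_kA₀ = B`, `δ_{k,Ax}(A₀)`): `torusHax w c k A₀ − H_kB = ∂λ_k(H_kB)` with `H_kB = Hk (opsV1 P k c √w) B`
  read as a bond function and `λ_k = lamOf c k`; `prop511_torus_of_avg` — the same from `Q_kA = B` alone with the representative
  `A + ∂λ_k(A)`; `lam_mem_kerQp_torus` — the gauge function lies in `N(Q′_k)`.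
Carrier clauses (F6): standing range of `Setup`; `c ≠ 0`, `w > 0`.  New definitions: `axialSub`, `axialE`, `lamE` (carriers only; no
`def … : Prop`).  Axioms: the standard three.
-/

namespace Literature.MathematicalPhysics.QuantumFieldTheory.BalabanImbrieJaffe1984to88.BIJ85Prop511Torus

open MeasureTheory
open Literature.MathematicalPhysics.QuantumFieldTheory.Balaban1983to89
open LatticeFieldCalculus
open Literature.MathematicalPhysics.QuantumFieldTheory.BalabanImbrieJaffe1984to88.BIJ85AxialPropagator411
open Literature.MathematicalPhysics.QuantumFieldTheory.BalabanImbrieJaffe1984to88.BIJ85AxialMinimizer413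
open Literature.MathematicalPhysics.QuantumFieldTheory.BalabanImbrieJaffe1984to88.BIJ85LandauForm441
open Literature.MathematicalPhysics.QuantumFieldTheory.BalabanImbrieJaffe1984to88.BIJ85LandauMinimizer442
open Literature.MathematicalPhysics.QuantumFieldTheory.BalabanImbrieJaffe1984to88.BIJ85LandauMinimizer442V1
open Literature.MathematicalPhysics.QuantumFieldTheory.BalabanImbrieJaffe1984to88.BIJ85GaugeFunction5113 (lamOf)
open Literature.MathematicalPhysics.QuantumFieldTheory.BalabanImbrieJaffe1984to88.BIJ85Eq5113Proof
  (lamOf_add lamOf_smul lamOf_zero siteAvgIter_lamOf deltaAx_lamOf eq5113)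
open Literature.MathematicalPhysics.QuantumFieldTheory.BalabanImbrieJaffe1984to88.BIJ85Prop511Proof

noncomputable section

variable {P : Params}

/-! ## §1  The axial gauge `δ_{k,Ax}` as a subspace; the gauge-function map on the Euclidean carrier -/

/-- **(4.1.2)** *"δ_{k,Ax}(A) ≡ Π_{j=0}^{k−1} δ_{Ax}(Q_jA)"* — the support of the axial-gauge δ-functions ALONE, as a linear subspace of
the η-lattice bond fields (p09's `constraint411 k` is its intersection with `{Q_kA = 0}`). [cite: BalabanImbrieJaffe1985, (4.1.2) p.309] -/
def axialSub (k : ℕ) : Submodule ℝ (VecField P 0 ℝ) where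
  carrier := {A | deltaAx k A}
  zero_mem' := fun j _ => by rw [bondAvgIter_map_zero]; exact isAxial_zero
  add_mem' := by
    intro A B hA hB j hj
    rw [bondAvgIter_add]
    exact isAxial_add (hA j hj) (hB j hj)
  smul_mem' := by
    intro a A hA j hj
    rw [bondAvgIter_smul]
    exact isAxial_smul a (hA j hj)

/-- membership: `A ∈ axialSub k ↔ δ_{k,Ax}(A)`. [cite: BalabanImbrieJaffe1985, (4.1.2) p.309] -/
theorem mem_axialSub (k : ℕ) (A : VecField P 0 ℝ) : A ∈ (axialSub k : Submodule ℝ (VecField P 0 ℝ)) ↔ deltaAx k A := Iff.rfl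

variable (P) in
/-- `δ_{k,Ax}` carried to the Euclidean space `BondSpace P` of (4.1.1) (as p09's `V411` carries `constraint411`).
[cite: BalabanImbrieJaffe1985, (4.1.2) p.309] -/
def axialE (k : ℕ) : Submodule ℝ (BondSpace P) := (axialSub (P := P) k).map (toE P).toLinearMap

/-- the identification `BondSpace P → VecField P 0 ℝ` is `WithLp.ofLp`. [folklore] -/
private theorem toE_symm_apply' (v : BondSpace P) : (toE P).symm v = WithLp.ofLp v := rfl

/-- the identification `VecField P 0 ℝ → BondSpace P` is `WithLp.toLp`. [folklore] -/
private theorem toE_apply' (A : VecField P 0 ℝ) : toE P A = WithLp.toLp 2 A := rfl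

/-- membership in `axialE`: the underlying bond field satisfies `δ_{k,Ax}`. [cite: BalabanImbrieJaffe1985, (4.1.2) p.309] -/
theorem mem_axialE (k : ℕ) (v : BondSpace P) : v ∈ axialE P k ↔ deltaAx k (WithLp.ofLp v) := by
  unfold axialE
  rw [Submodule.mem_map]
  constructor
  · rintro ⟨A, hA, rfl⟩
    exact hA
  · intro h
    exact ⟨WithLp.ofLp v, h, rfl⟩

/-- p09's domain `V411 P k` of (4.1.1) is `{Q_kA = 0} ∩ δ_{k,Ax}` — hypothesis `hV` of file 1 for the V1 operators.
[cite: BalabanImbrieJaffe1985, (4.1.1)–(4.1.2) p.309] -/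
theorem mem_V411_iff (k : ℕ) (c s : ℝ) (v : BondSpace P) :
    v ∈ V411 P k ↔ (opsV1 P k c s).Qk v = 0 ∧ v ∈ axialE P k := by
  rw [mem_V411, opsV1_Qk, mem_axialE, toE_symm_apply']

variable (P) in
/-- **the gauge function `λ = λ(A)` of (5.1.13)** (p08's `lamOf c k`) as an `ℝ`-linear map on the Euclidean carriers (*"We now notice
that λ = λ(A) is a linear function of A"*, p. 315). [cite: BalabanImbrieJaffe1985, (5.1.13) p.315] -/
def lamE (c : ℝ) (k : ℕ) : BondSpace P →ₗ[ℝ] EuclideanSpace ℝ (Site P 0) where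
  toFun v := WithLp.toLp 2 (lamOf c k (WithLp.ofLp v))
  map_add' v w := by rw [WithLp.ofLp_add, lamOf_add, WithLp.toLp_add]
  map_smul' a v := by rw [WithLp.ofLp_smul, lamOf_smul, WithLp.toLp_smul, RingHom.id_apply]

/-- unfolding `lamE`. [cite: BalabanImbrieJaffe1985, (5.1.13) p.315] -/
@[simp] theorem lamE_apply (c : ℝ) (k : ℕ) (v : BondSpace P) :
    lamE P c k v = WithLp.toLp 2 (lamOf c k (WithLp.ofLp v)) := rfl

/-! ## §2  The hypotheses of the abstract theorem HOLD for the V1 operators (standing range) -/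

/-- `hlamQ`: `Q′_kλ(A) = 0` (the δ-function `δ(Q′_kλ)`), p08's `siteAvgIter_lamOf`. [cite: BalabanImbrieJaffe1985, (5.1.13) p.315] -/
theorem lamE_Qp {k : ℕ} (hk : k ≤ P.m + P.K) (c s : ℝ) (v : BondSpace P) :
    (opsV1 P k c s).Qp (lamE P c k v) = 0 := by
  rw [opsV1_Qp, lamE_apply, WithLp.ofLp_toLp, siteAvgIter_lamOf c k hk]

/-- `hlamAx`: `δ_{k,Ax}(A + ∂λ(A))`, p08's `deltaAx_lamOf`. [cite: BalabanImbrieJaffe1985, (5.1.13) p.315] -/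
theorem lamE_axial {k : ℕ} (hk : k ≤ P.m + P.K) {c : ℝ} (hc : c ≠ 0) (v : BondSpace P) :
    v + gradV1 P c (lamE P c k v) ∈ axialE P k := by
  rw [mem_axialE, WithLp.ofLp_add, gradV1_apply, lamE_apply, WithLp.ofLp_toLp, WithLp.ofLp_toLp]
  exact deltaAx_lamOf hc k hk _

/-- `hlamU`: UNIQUENESS of the gauge function (p08's `eq5113`): any `μ ∈ N(Q′_k)` with `δ_{k,Ax}(A + ∂μ)` is `λ(A)`.
[cite: BalabanImbrieJaffe1985, (5.1.13) p.315] -/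
theorem lamE_unique {k : ℕ} (hk : k ≤ P.m + P.K) {c : ℝ} (hc : c ≠ 0) (s : ℝ) (v : BondSpace P)
    (μ : EuclideanSpace ℝ (Site P 0)) (hμ : (opsV1 P k c s).Qp μ = 0) (hax : v + gradV1 P c μ ∈ axialE P k) :
    μ = lamE P c k v := by
  rw [opsV1_Qp] at hμ
  rw [mem_axialE, WithLp.ofLp_add, gradV1_apply, WithLp.ofLp_toLp] at hax
  have h := eq5113 hk hc hμ hax
  rw [lamE_apply, ← h, WithLp.toLp_ofLp]

/-- p09's weighted curl `curlOp w c` of (4.1.1) IS the V1 operator `(opsV1 P k c √w).curl` (same Euclidean carriers; `s = √w`).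
[cite: BalabanImbrieJaffe1985, (4.1.1) p.309] -/
theorem curlOp_eq_opsV1_curl (k : ℕ) (w c : ℝ) :
    curlOp (P := P) w c = (opsV1 P k c (Real.sqrt w)).curl := by
  apply LinearMap.ext
  intro v
  rw [opsV1_curl]
  rfl

/-! ## §3  p. 309 on the Euclidean carrier, via file 1 (the bond-function form for every k is p33 gen 2's
`…BIJ85NoZeroModes309Torus.noZeroModes_torus` / `hD_holds`, landed while this file was being written — not restated here) -/

/-- **p. 309 for the V1 operators, every `k ≤ m + K`** (verbatim: *"Such zero modes do not occur … A similar argument applies to the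
δ_{k,Ax} gauge, but we leave out the details"*): for `c ≠ 0`, `s ≠ 0`, a vector of `BondSpace P` with `Q_kv = 0`, `v ∈ δ_{k,Ax}` and
`∂v = 0` vanishes — file 1's `noZeroModes_axial` (Landau no-zero-modes `noZeroModes_V1` = [6I] p. 30, p11; uniqueness of λ = p08's
`eq5113`).  The bond-function form in the shape of p09's hypothesis `hD` is p33 gen 2's `BIJ85NoZeroModes309Torus.hD_holds` (a
different route: block constants + the induction in k); this is the second, independent proof. [cite: BalabanImbrieJaffe1985, p.309 (text)] -/
theorem noZeroModes_axialE {k : ℕ} (hk : k ≤ P.m + P.K) {c s : ℝ} (hc : c ≠ 0) (hs : s ≠ 0) {v : BondSpace P}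
    (hQ : (opsV1 P k c s).Qk v = 0) (hax : v ∈ axialE P k) (hcurl : (opsV1 P k c s).curl v = 0) : v = 0 :=
  noZeroModes_axial (opsV1 P k c s) (noZeroModes_V1 hk hc hs) (gaugeStructure_V1 hk c s) (axialE P k) (lamE P c k)
    (fun A μ hμ hax => lamE_unique hk hc s A μ hμ hax) hQ hax hcurl

/-! ## §4  Proposition 5.1.1 on the torus -/

/-- **Proposition 5.1.1 on `T^{(0)}`** ([BalabanImbrieJaffe1985] p. 314 with (5.1.1) p. 313, verbatim: *"H_{k,Ax}B − H_kB = ∂λ. (5.1.1)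
… Proposition 5.1.1. The relation (5.1.1) holds with [λ of (5.1.4)]"*), HYPOTHESIS-FREE in the standing range: for `k ≤ m + K`,
`c ≠ 0` (lattice factor `c = η⁻¹` of `∂`), `w > 0` (volume weight `η^d` of the norms), every `B` on `T₁^{(k)}` and every axial
representative `A₀` (`Q_kA₀ = B`, `δ_{k,Ax}(A₀)`): the axial gauge minimizer (4.1.3) `torusHax w c k A₀` of p09 and the Landau gauge
minimizer (4.4.2) `H_kB = Hk (opsV1 P k c √w) B` of p11 differ by the gradient of `λ_k(H_kB)`, `λ_k = lamOf c k` the gauge function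
(5.1.13)/(5.1.4) of p08 (at the printed normalisation `c = L^k` its weights are `L^{j−k}`: `BIJ85GaugeFunction5113.eq5113_unit`).
[cite: BalabanImbrieJaffe1985, Prop. 5.1.1 p.314] -/
theorem prop511_torus {k : ℕ} (hk : k ≤ P.m + P.K) {c : ℝ} (hc : c ≠ 0) {w : ℝ} (hw : 0 < w)
    {B : VecField P k ℝ} {A₀ : VecField P 0 ℝ} (hQ : bondAvgIter k A₀ = B) (hax : deltaAx k A₀) :
    torusHax w c k A₀ - WithLp.ofLp (Hk (opsV1 P k c (Real.sqrt w)) B) =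
      grad c (lamOf c k (WithLp.ofLp (Hk (opsV1 P k c (Real.sqrt w)) B))) := by
  set s : ℝ := Real.sqrt w with hs'
  have hs : s ≠ 0 := (Real.sqrt_pos.2 hw).ne'
  have hA₀ : (opsV1 P k c s).Qk (toE P A₀) = B := by rw [opsV1_Qk, toE_apply', WithLp.ofLp_toLp, hQ]
  have hA₀Ax : toE P A₀ ∈ axialE P k := by rw [mem_axialE, toE_apply', WithLp.ofLp_toLp]; exact hax
  have h := prop511 (opsV1 P k c s) (noZeroModes_V1 hk hc hs) (fun l => lapInjective_V1 k hc hs l)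
    (gaugeStructure_V1 hk c s) (Ax := axialE P k) (V := V411 P k) (fun v => mem_V411_iff k c s v) (lamE P c k)
    (fun v => lamE_Qp hk c s v) (fun v => lamE_axial hk hc v) (fun A μ hμ hax => lamE_unique hk hc s A μ hμ hax) hA₀ hA₀Ax
  -- back to bond functions
  have h' := congrArg (fun x : BondSpace P => WithLp.ofLp x) h
  simp only [WithLp.ofLp_sub, gradV1_apply, lamE_apply, WithLp.ofLp_toLp] at h'
  rw [← h']
  unfold torusHax
  rw [curlOp_eq_opsV1_curl k w c, toE_symm_apply']

/-- Proposition 5.1.1 on `T^{(0)}` solved for the axial minimizer: `H_{k,Ax}B = H_kB + ∂λ_k(H_kB)` (*"Thus H_{k,Ax}B = H_kB + ∂λ(H_kB)"*,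
p. 315). [cite: BalabanImbrieJaffe1985, (5.1.15) p.315] -/
theorem torusHax_eq_Hk_add_grad {k : ℕ} (hk : k ≤ P.m + P.K) {c : ℝ} (hc : c ≠ 0) {w : ℝ} (hw : 0 < w)
    {B : VecField P k ℝ} {A₀ : VecField P 0 ℝ} (hQ : bondAvgIter k A₀ = B) (hax : deltaAx k A₀) :
    torusHax w c k A₀ = WithLp.ofLp (Hk (opsV1 P k c (Real.sqrt w)) B) +
      grad c (lamOf c k (WithLp.ofLp (Hk (opsV1 P k c (Real.sqrt w)) B))) := by
  rw [← prop511_torus hk hc hw hQ hax, add_sub_cancel]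

/-- Proposition 5.1.1 on `T^{(0)}` from `Q_kA = B` ALONE, with the axial representative `A + ∂λ_k(A)` supplied by the gauge function
itself (p08's `deltaAx_lamOf`, `bondAvgIter_add_grad_lamOf`). [cite: BalabanImbrieJaffe1985, Prop. 5.1.1 p.314] -/
theorem prop511_torus_of_avg {k : ℕ} (hk : k ≤ P.m + P.K) {c : ℝ} (hc : c ≠ 0) {w : ℝ} (hw : 0 < w)
    {B : VecField P k ℝ} {A : VecField P 0 ℝ} (hQ : bondAvgIter k A = B) :
    torusHax w c k (A + grad c (lamOf c k A)) - WithLp.ofLp (Hk (opsV1 P k c (Real.sqrt w)) B) =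
      grad c (lamOf c k (WithLp.ofLp (Hk (opsV1 P k c (Real.sqrt w)) B))) :=
  prop511_torus hk hc hw (by rw [BIJ85Eq5113Proof.bondAvgIter_add_grad_lamOf hk, hQ]) (deltaAx_lamOf hc k hk A)

/-- EVERY `B` on `T₁^{(k)}` is reached (`Q_k` is onto, p11's `B5AveragingOnto.bondAvgIter_surjective`), so Proposition 5.1.1 on the
torus holds for every `B` with the representative `A + ∂λ_k(A)`, `A` any preimage. [cite: BalabanImbrieJaffe1985, Prop. 5.1.1 p.314] -/
theorem prop511_torus_forall {k : ℕ} (hk : k ≤ P.m + P.K) {c : ℝ} (hc : c ≠ 0) {w : ℝ} (hw : 0 < w) (B : VecField P k ℝ) :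
    ∃ A : VecField P 0 ℝ, bondAvgIter k A = B ∧
      torusHax w c k (A + grad c (lamOf c k A)) - WithLp.ofLp (Hk (opsV1 P k c (Real.sqrt w)) B) =
        grad c (lamOf c k (WithLp.ofLp (Hk (opsV1 P k c (Real.sqrt w)) B))) := by
  obtain ⟨A, hA⟩ := B5AveragingOnto.bondAvgIter_surjective hk B
  exact ⟨A, hA, prop511_torus_of_avg hk hc hw hA⟩

/-- the gauge function of (5.1.1) on the torus lies in `N(Q′_k)`: `Q′_k(λ_k(H_kB)) = 0` (the δ-function `δ(Q′_kλ)` of (5.1.9)).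
[cite: BalabanImbrieJaffe1985, (5.1.9) p.314] -/
theorem lam_mem_kerQp_torus {k : ℕ} (hk : k ≤ P.m + P.K) (c s : ℝ) (B : VecField P k ℝ) :
    siteAvgIter k (lamOf c k (WithLp.ofLp (Hk (opsV1 P k c s) B))) = 0 :=
  siteAvgIter_lamOf c k hk _

/-- **`H_kB` minimizes `½‖∂A‖²` over the WHOLE fibre `{Q_kA = B}` on the torus** (p. 313 / p. 315; file 1's `Hk_minimizes_on_fibre`
for the V1 operators, hypothesis-free): `½‖∂H_kB‖² ≤ ½‖∂A‖²` whenever `Q_kA = B` (`k ≤ m + K`, `c ≠ 0`, `s ≠ 0`).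
[cite: BalabanImbrieJaffe1985, p.313 (text)] -/
theorem Hk_minimizes_on_fibre_V1 {k : ℕ} (hk : k ≤ P.m + P.K) {c s : ℝ} (hc : c ≠ 0) (hs : s ≠ 0)
    {B : VecField P k ℝ} {A : BondSpace P} (hA : (opsV1 P k c s).Qk A = B) :
    (1 / 2 : ℝ) * ‖(opsV1 P k c s).curl (Hk (opsV1 P k c s) B)‖ ^ 2 ≤ (1 / 2 : ℝ) * ‖(opsV1 P k c s).curl A‖ ^ 2 :=
  Hk_minimizes_on_fibre (opsV1 P k c s) (noZeroModes_V1 hk hc hs) (fun l => lapInjective_V1 k hc hs l)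
    (gaugeStructure_V1 hk c s) hA

/-! ## §5  (5.2.8) on the torus — v1.1 append (p30 gen 4) -/

/-- **(5.2.8) on `T^{(0)}`** (p. 316: *"the fact that H*_{j,Ax}∂* = H*_j∂*, (5.2.8) is gauge invariant"*), configuration form: the axial
and the Landau gauge minimizers have THE SAME PLAQUETTE FIELD, `∂(torusHax w c k A₀) = ∂(H_kB)` pointwise, for `k ≤ m + K`, `c ≠ 0`,
`w > 0`, every `B` and every axial representative `A₀` (Prop. 5.1.1 on the torus + `∂∂λ = 0`, `LatticeFieldCalculus.curl_grad`).
[cite: BalabanImbrieJaffe1985, (5.2.8) p.316] -/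
theorem eq528_torus {k : ℕ} (hk : k ≤ P.m + P.K) {c : ℝ} (hc : c ≠ 0) {w : ℝ} (hw : 0 < w)
    {B : VecField P k ℝ} {A₀ : VecField P 0 ℝ} (hQ : bondAvgIter k A₀ = B) (hax : deltaAx k A₀) (p : Plaq P 0) :
    curl c (torusHax w c k A₀) p = curl c (WithLp.ofLp (Hk (opsV1 P k c (Real.sqrt w)) B)) p := by
  rw [torusHax_eq_Hk_add_grad hk hc hw hQ hax]
  have h := curl_add c (WithLp.ofLp (Hk (opsV1 P k c (Real.sqrt w)) B))
    (grad c (lamOf c k (WithLp.ofLp (Hk (opsV1 P k c (Real.sqrt w)) B)))) p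
  rw [curl_grad, add_zero] at h
  exact h

/-- … hence the same gauge-field action `½Σ_p η^d|∂A(p)|²` (`curlAction`): both minimize it on the fibre `Q_kA = B` (p. 313).
[cite: BalabanImbrieJaffe1985, p.313 (text)] -/
theorem curlAction_torusHax_eq {k : ℕ} (hk : k ≤ P.m + P.K) {c : ℝ} (hc : c ≠ 0) {w : ℝ} (hw : 0 < w)
    {B : VecField P k ℝ} {A₀ : VecField P 0 ℝ} (hQ : bondAvgIter k A₀ = B) (hax : deltaAx k A₀) :
    curlAction w c (torusHax w c k A₀) = curlAction w c (WithLp.ofLp (Hk (opsV1 P k c (Real.sqrt w)) B)) := by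
  unfold curlAction
  simp_rw [eq528_torus hk hc hw hQ hax]

end

end Literature.MathematicalPhysics.QuantumFieldTheory.BalabanImbrieJaffe1984to88.BIJ85Prop511Torus
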